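import Literature.MathematicalPhysics.StatisticalMechanics.MonomerDimerZeros
import Literature.MathematicalPhysics.StatisticalMechanics.TruncatedCorrelationFunction
import HarnessLib

/-!
# Connectedness of the truncated functions of capacity (complex spin / monomer–dimer) systems
# (Salmhofer–Seiler, CMP 139 (1991), Thm. 3.11: why the decay rate is the TREE LENGTH)

A further file of the Salmhofer–Seiler series.  Theorem 3.11 (p. 407, with the 1992 Erratum) bounds
the truncated `n`-point functions `⟨σ_{x₁} ⋯ σ_{x_n}⟩^T` of the NJL complex spin system by
`C e^{-κ(m) ϑ(x₁,…,x_n)}`, "`ϑ(x₁,…,x_n)` the length of a minimal tree on `{x₁,…,x_n}`".  In the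
printed proof the tree length enters through the cluster expansion at large `|m|` ("for `|m| > m₀`,
the cluster expansion converges and the truncated correlations decay exponentially,
`u_L(m) ≤ -K(m) < 0`", p. 408): connected correlations are sums over CONNECTED clusters of dimers
joining all the sources, and a connected cluster joining `x₁, …, x_n` contains at least `ϑ` dimers,
each worth a factor `m^{-2}`.  This file proves the algebraic content of that statement exactly, for
the capacity systems `Z(c) = [∏ σ_x^{c_x}] ∏_x F_x(σ_x) ∏_b B_b(σ_{s b}σ_{t b})` of the tree's
`MonomerDimerZeros` (general finite vertex set, bonds with end points `s t : β → V`, any site data,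
bond data with constant Taylor coefficient `B_b(0) = 1`), WITHOUT a cluster expansion:

* give every bond `b` a formal variable `t_b` and replace its Taylor data `g_b(j)` by `g_b(j) t_b^j`
  (`genBond`); the capacity partition functions become polynomials `Z̃(c) ∈ 𝕜[t_b : b ∈ β]`
  (`Zgen`), and so does the cleared-denominator truncated function of a family of monomial
  observables `σ^{L_i}`, `i ∈ S` (`ursellGen`, built with `Ursell.clearedUrsell` from
  `z(A) = Z̃(c₀ - ∑_{i∈A} L_i)` and `z₀ = Z̃(c₀)`);
* **`isLinking_of_mem_support_ursellGen`**: every monomial `∏ t_b^{k_b}` occurring in that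
  polynomial has a bond support `K = {b : k_b ≠ 0}` which LINKS the observables — no proper
  sub-family is separated from the rest in the graph generated by `K` (`IsLinking`).  Proof: the
  coefficient of `t^k` is unchanged by killing the variables outside `K` (`coeff_killVars`); after the
  killing, at every numerical value of the remaining variables the partition functions FACTORISE
  across the cut between the `K`-hull of a separated sub-family and its complement
  (`Z_eq_mul_of_separated`), so the genuine truncated function vanishes by the independence lemma
  (`Ursell.ursell_eq_zero_of_factorizes`); by `MvPolynomial.funext` (infinite field) and integrality
  the killed polynomial is zero;
* hence **`steiner_le_degree_of_mem_support_ursellGen`**: its total degree is at least the Steiner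
  (minimal connecting) bond number `steiner s t L S` of the observables — the tree length.

The companion file `NJLTruncatedClustering` specialises to the NJL system, where `t_b = m^{-2}`
after scaling, so that the truncated functions vanish at `m = ∞` to order `|L| + 2ϑ`, and the
Penrose–Lebowitz / Schwarz-lemma step of `NJLExponentialClustering` turns this order of vanishing
into the decay rate `κ(m) ϑ` on the whole mass region.

## Contents

* `MonomerDimer.bondGraph`, `IsLinking`, `steiner`, `steiner_le_card`;
* `genBond`, `Zgen`, `ursellGen`; `scaledBond` (numerical bond data `g_b(j) τ_b^j`), `eval_Zgen`,
  `eval_ursellGen`; `killVars` (with the private `coeff_killVars`, `eval_killVars`);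
* `coeff_mul_of_supported` (coefficients of a product of polynomials in disjoint variables),
  `Z_eq_mul_of_separated` (factorisation across a cut crossed by no live bond), `Z_trivialBonds`
  (`Z(c) = ∏_x f_x(c_x)` when all bonds are off);
* `isLinking_of_mem_support_ursellGen`, `steiner_le_degree_of_mem_support_ursellGen`.

Honest framing: finite algebra of polynomial "spin systems"; nothing here is about `β > 0` lattice
gauge theory, the continuum, a mass gap or the summit's `QCD` conjunct.

## References

* M. Salmhofer, E. Seiler, *Proof of chiral symmetry breaking in strongly coupled lattice gauge
  theory*, Commun. Math. Phys. 139 (1991) 395–432: Thm. 3.11 and its proof, pp. 407–409; Def. 3.1,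
  Remark 3.2, (3.5)–(3.7). [SalmhoferSeiler1991]
* R. Haag, *Local Quantum Physics* (2nd ed., 1996), §II.2.2. [Haag1996]
-/

noncomputable section

open MvPolynomial Finset

namespace Literature.MathematicalPhysics.StatisticalMechanics

namespace MonomerDimer

/-! ### Bond graphs, linking bond sets, the Steiner number -/

section Graph

variable {V β ι : Type*} (s t : β → V)

/-- The graph on the vertex set generated by a set of bonds `K`: `x ∼ y` iff `x ≠ y` are the two end
points of a bond of `K` (self-bonds generate nothing). [cite: SalmhoferSeiler1991, (3.5)–(3.7)] -/
def bondGraph (K : Set β) : SimpleGraph V :=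
  SimpleGraph.fromEdgeSet ((fun b => s(s b, t b)) '' K)

/-- The two end points of a bond of `K` are joined in the graph of `K`. [cite: SalmhoferSeiler1991, (3.5)–(3.7)] -/
theorem bondGraph_reachable {K : Set β} {b : β} (hb : b ∈ K) :
    (bondGraph s t K).Reachable (s b) (t b) := by
  by_cases h : s b = t b
  · rw [h]
  · apply SimpleGraph.Adj.reachable
    rw [bondGraph, SimpleGraph.fromEdgeSet_adj]
    exact ⟨⟨b, hb, rfl⟩, h⟩

/-- Monotonicity of the bond graph in the bond set. [cite: SalmhoferSeiler1991, (3.5)–(3.7)] -/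
theorem bondGraph_mono {K K' : Set β} (h : K ⊆ K') : bondGraph s t K ≤ bondGraph s t K' :=
  SimpleGraph.fromEdgeSet_mono (Set.image_mono h)

/-- **A bond set `K` links the family of observables `σ^{L_i}`, `i ∈ S`**: no proper nonempty
sub-family `I ⊊ S` is separated from the rest, i.e. some site of some `supp L_i`, `i ∈ I`, is
joined through bonds of `K` to some site of some `supp L_j`, `j ∈ S ∖ I`.  (For single-site
observables: all the sites lie in one connected component of the graph of `K` — `K` contains a tree
on them.) [cite: SalmhoferSeiler1991, Thm. 3.11] -/
def IsLinking (K : Set β) (L : ι → V →₀ ℕ) (S : Finset ι) : Prop :=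
  ∀ I ⊆ S, I.Nonempty → I ≠ S →
    ∃ i ∈ I, ∃ j ∈ S, j ∉ I ∧
      ∃ x ∈ (L i).support, ∃ y ∈ (L j).support, (bondGraph s t K).Reachable x y

/-- Linking is monotone in the bond set. [cite: SalmhoferSeiler1991, Thm. 3.11] -/
theorem IsLinking.mono {K K' : Set β} {L : ι → V →₀ ℕ} {S : Finset ι} (h : IsLinking s t K L S)
    (hKK' : K ⊆ K') : IsLinking s t K' L S := by
  intro I hI hIne hIS
  obtain ⟨i, hi, j, hj, hjI, x, hx, y, hy, hxy⟩ := h I hI hIne hIS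
  exact ⟨i, hi, j, hj, hjI, x, hx, y, hy, hxy.mono (bondGraph_mono s t hKK')⟩

/-- **The Steiner number (tree length)** `ϑ(L, S)` of the family: the least number of bonds in a
bond set linking it — "the length of a minimal tree on `{x₁, …, x_n}`" (`0` if no finite bond set
links the family, a case in which the bounds below hold trivially). [cite: SalmhoferSeiler1991, Thm. 3.11 (3.32)] -/
def steiner (L : ι → V →₀ ℕ) (S : Finset ι) : ℕ :=
  sInf {n : ℕ | ∃ K : Finset β, K.card = n ∧ IsLinking s t (↑K : Set β) L S}

/-- Every linking bond set has at least `ϑ` bonds. [cite: SalmhoferSeiler1991, Thm. 3.11 (3.32)] -/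
theorem steiner_le_card {L : ι → V →₀ ℕ} {S : Finset ι} {K : Finset β}
    (h : IsLinking s t (↑K : Set β) L S) : steiner s t L S ≤ K.card :=
  Nat.sInf_le ⟨K, rfl, h⟩

end Graph

/-! ### Coefficients of products of polynomials in disjoint sets of variables -/

section Supported

variable {σ R : Type*} [CommRing R]

/-- `X_i ∈ 𝕜[X_j : j ∈ s]` for `i ∈ s` (no nontriviality needed). [folklore] -/
private theorem X_mem_supported' {s : Set σ} {i : σ} (hi : i ∈ s) :
    (X i : MvPolynomial σ R) ∈ supported R s := by
  rw [supported_eq_adjoin_X]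
  exact Algebra.subset_adjoin ⟨i, hi, rfl⟩

/-- **Coefficients of a product of polynomials in disjoint variables**: if `p` only involves
variables in `P` and `q` only variables outside `P`, the coefficient of `σ^c` in `p q` is the product
of the coefficients of the two halves of `c`. [folklore] -/
private theorem coeff_mul_of_supported (P : σ → Prop) [DecidablePred P] {p q : MvPolynomial σ R}
    (hp : p ∈ supported R {x | P x}) (hq : q ∈ supported R {x | ¬P x}) (c : σ →₀ ℕ) :
    coeff c (p * q) = coeff (c.filter P) p * coeff (c.filter fun x => ¬P x) q := by
  classical
  rw [coeff_mul]
  have hvp : ∀ d : σ →₀ ℕ, coeff d p ≠ 0 → ∀ x ∈ d.support, P x := by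
    intro d hd x hx
    have hxv : x ∈ p.vars := (mem_vars_iff_mem_support x).2 ⟨d, mem_support_iff.2 hd, hx⟩
    exact (mem_supported.1 hp) hxv
  have hvq : ∀ e : σ →₀ ℕ, coeff e q ≠ 0 → ∀ x ∈ e.support, ¬P x := by
    intro e he x hx
    have hxv : x ∈ q.vars := (mem_vars_iff_mem_support x).2 ⟨e, mem_support_iff.2 he, hx⟩
    exact (mem_supported.1 hq) hxv
  have key : ∀ d e : σ →₀ ℕ, d + e = c → coeff d p * coeff e q ≠ 0 →
      d = c.filter P ∧ e = c.filter fun x => ¬P x := by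
    intro d e hde hne
    have hd := hvp d (left_ne_zero_of_mul hne)
    have he := hvq e (right_ne_zero_of_mul hne)
    have hpt : ∀ x, d x + e x = c x := fun x => by
      have := DFunLike.congr_fun hde x
      simpa using this
    constructor
    · ext x
      rw [Finsupp.filter_apply]
      by_cases hx : P x
      · rw [if_pos hx]
        have hex : e x = 0 := by
          by_contra h
          exact he x (Finsupp.mem_support_iff.2 h) hx
        have := hpt x
        omega
      · rw [if_neg hx]
        by_contra h
        exact hx (hd x (Finsupp.mem_support_iff.2 h))
    · ext x
      rw [Finsupp.filter_apply]
      by_cases hx : P x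
      · rw [if_neg (not_not_intro hx)]
        by_contra h
        exact he x (Finsupp.mem_support_iff.2 h) hx
      · rw [if_pos hx]
        have hdx : d x = 0 := by
          by_contra h
          exact hx (hd x (Finsupp.mem_support_iff.2 h))
        have := hpt x
        omega
  rw [Finset.sum_eq_single (c.filter P, c.filter fun x => ¬P x)]
  · rintro ⟨d, e⟩ hde hne
    by_contra h
    obtain ⟨rfl, rfl⟩ := key d e (Finset.HasAntidiagonal.mem_antidiagonal.1 hde) h
    exact hne rfl
  · intro h
    exact absurd (Finset.HasAntidiagonal.mem_antidiagonal.2 (Finsupp.filter_add_filter_not c P)) h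

variable {V β : Type*}

/-- A site factor only involves its own variable. [cite: SalmhoferSeiler1991, Def. 3.1] -/
private theorem siteFactor_mem_supported (D : ℕ) (f : V → ℕ → R) {S : Set V} {x : V} (hx : x ∈ S) :
    siteFactor D f x ∈ supported R S := by
  unfold siteFactor
  refine Subalgebra.sum_mem _ fun j _ => Subalgebra.mul_mem _ ?_ (Subalgebra.pow_mem _ ?_ _)
  · rw [← algebraMap_eq]; exact Subalgebra.algebraMap_mem _ _
  · exact X_mem_supported' hx

/-- A bond factor only involves the variables of its two end points. [cite: SalmhoferSeiler1991, Def. 3.1] -/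
private theorem bondFactor_mem_supported (D : ℕ) (s t : β → V) (g : β → ℕ → R) {S : Set V} {b : β}
    (hs : s b ∈ S) (ht : t b ∈ S) : bondFactor D s t g b ∈ supported R S := by
  unfold bondFactor
  refine Subalgebra.sum_mem _ fun j _ => Subalgebra.mul_mem _ ?_ (Subalgebra.pow_mem _ ?_ _)
  · rw [← algebraMap_eq]; exact Subalgebra.algebraMap_mem _ _
  · exact Subalgebra.mul_mem _ (X_mem_supported' hs) (X_mem_supported' ht)

variable [Fintype V] [Fintype β]

/-- **Factorisation across a cut.**  If every bond either has both end points on the same side of the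
cut `P ⊔ Pᶜ` or is switched off (`B_b ≡ 1`), then the capacity partition functions factorise:
`Z(c) = Z₁(c|_P) · Z₂(c|_{Pᶜ})` for all capacities `c`. [cite: SalmhoferSeiler1991, Def. 3.1 and (3.5)–(3.7)] -/
theorem Z_eq_mul_of_separated (D : ℕ) (s t : β → V) (f : V → ℕ → R) (g : β → ℕ → R)
    (P : V → Prop) [DecidablePred P]
    (hsep : ∀ b, (P (s b) ↔ P (t b)) ∨ bondFactor D s t g b = 1) :
    ∃ Z₁ Z₂ : (V →₀ ℕ) → R,
      ∀ c, Z D s t f g c = Z₁ (c.filter P) * Z₂ (c.filter fun x => ¬P x) := by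
  classical
  set B₁ : MvPolynomial V R :=
    (∏ x ∈ univ.filter (fun x => P x), siteFactor D f x) *
      ∏ b ∈ univ.filter (fun b => P (s b)), bondFactor D s t g b with hB₁
  set B₂ : MvPolynomial V R :=
    (∏ x ∈ univ.filter (fun x => ¬P x), siteFactor D f x) *
      ∏ b ∈ univ.filter (fun b => ¬P (s b)), bondFactor D s t g b with hB₂
  have hB : boltzmann D s t f g = B₁ * B₂ := by
    unfold boltzmann
    rw [← prod_filter_mul_prod_filter_not univ (fun x => P x),
      ← prod_filter_mul_prod_filter_not univ (fun b => P (s b)), hB₁, hB₂]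
    ring
  have h1 : B₁ ∈ supported R {x | P x} := by
    refine Subalgebra.mul_mem _ (Subalgebra.prod_mem _ fun x hx => ?_)
      (Subalgebra.prod_mem _ fun b hb => ?_)
    · exact siteFactor_mem_supported D f (mem_filter.1 hx).2
    · have hsb : P (s b) := (mem_filter.1 hb).2
      rcases hsep b with h | h
      · exact bondFactor_mem_supported D s t g hsb (h.1 hsb)
      · rw [h]; exact Subalgebra.one_mem _
  have h2 : B₂ ∈ supported R {x | ¬P x} := by
    refine Subalgebra.mul_mem _ (Subalgebra.prod_mem _ fun x hx => ?_)
      (Subalgebra.prod_mem _ fun b hb => ?_)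
    · exact siteFactor_mem_supported D f (mem_filter.1 hx).2
    · have hsb : ¬P (s b) := (mem_filter.1 hb).2
      rcases hsep b with h | h
      · exact bondFactor_mem_supported D s t g hsb (fun ht => hsb (h.2 ht))
      · rw [h]; exact Subalgebra.one_mem _
  refine ⟨fun c => coeff c B₁, fun c => coeff c B₂, fun c => ?_⟩
  unfold Z
  rw [hB, coeff_mul_of_supported P h1 h2]

omit [Fintype V] [Fintype β] in
/-- A bond whose Taylor data vanish beyond the constant term `1` is switched off: `B_b = 1`.
[cite: SalmhoferSeiler1991, (3.5)–(3.6)] -/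
theorem bondFactor_eq_one {D : ℕ} {s t : β → V} {g : β → ℕ → R} {b : β} (h0 : g b 0 = 1)
    (h : ∀ j, 1 ≤ j → g b j = 0) : bondFactor D s t g b = 1 := by
  unfold bondFactor
  rw [Finset.sum_eq_single 0]
  · simp [h0]
  · intro j _ hj
    rw [h j (Nat.one_le_iff_ne_zero.2 hj), C_0, zero_mul]
  · intro h'; exact absurd (mem_range.2 (Nat.succ_pos D)) h'

/-- **All bonds off**: `Z(c) = ∏_x f_x(c_x)` (`c ≤ D`) — only monomers. [cite: SalmhoferSeiler1991, (3.7)] -/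
theorem Z_trivialBonds [DecidableEq V] (D : ℕ) (s t : β → V) (f : V → ℕ → R) (g : β → ℕ → R)
    (hg : ∀ b, bondFactor D s t g b = 1) {c : V →₀ ℕ} (hc : ∀ x, c x ≤ D) :
    Z D s t f g c = ∏ x, f x (c x) := by
  unfold Z boltzmann
  rw [prod_congr rfl (fun b _ => hg b), prod_const_one, mul_one]
  unfold siteFactor
  rw [Finset.prod_univ_sum, coeff_sum]
  have hterm : ∀ φ : V → ℕ,
      (∏ x, C (f x (φ x)) * X x ^ (φ x) : MvPolynomial V R) =
        monomial (Finsupp.equivFunOnFinite.symm φ) (∏ x, f x (φ x)) := by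
    intro φ
    rw [prod_mul_distrib, ← map_prod C, monomial_eq, Finsupp.prod_fintype _ _ (fun _ => pow_zero _)]
    rfl
  simp_rw [hterm, coeff_monomial]
  rw [Finset.sum_eq_single (⇑c : V → ℕ)]
  · rw [if_pos (Finsupp.equivFunOnFinite_symm_coe c)]
  · intro φ _ hφ
    rw [if_neg]
    intro h
    apply hφ
    rw [← h]
    rfl
  · intro h
    exact absurd (Fintype.mem_piFinset.2 fun x => mem_range.2 (Nat.lt_succ_of_le (hc x))) h

end Supported

/-! ### Bond weights as formal variables -/

section Generic

variable {V β : Type*} {𝕜 : Type*} [Field 𝕜]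

/-- The bond data with a formal variable per bond: `g_b(j) ↦ g_b(j) t_b^j`, in `𝕜[t_b : b ∈ β]`.
[cite: SalmhoferSeiler1991, (3.5)–(3.6)] -/
def genBond (g : β → ℕ → 𝕜) : β → ℕ → MvPolynomial β 𝕜 :=
  fun b j => C (g b j) * X b ^ j

/-- The numerical bond data at the point `τ`: `g_b(j) τ_b^j`. [cite: SalmhoferSeiler1991, (3.5)–(3.6)] -/
def scaledBond (g : β → ℕ → 𝕜) (τ : β → 𝕜) : β → ℕ → 𝕜 :=
  fun b j => g b j * τ b ^ j

variable [Fintype V] [Fintype β]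

/-- The capacity partition function with formal bond variables,
`Z̃(c) = [∏ σ_x^{c_x}] ∏_x F_x(σ_x) ∏_b B_b(t_b σ_{s b}σ_{t b}) ∈ 𝕜[t]`. [cite: SalmhoferSeiler1991, Def. 3.1 and (3.5)–(3.7)] -/
def Zgen (D : ℕ) (s t : β → V) (f : V → ℕ → 𝕜) (g : β → ℕ → 𝕜) (c : V →₀ ℕ) :
    MvPolynomial β 𝕜 :=
  Z D s t (fun x j => C (f x j)) (genBond g) c

/-- Functoriality of the Boltzmann polynomial in the coefficient ring. [folklore] -/
private theorem map_boltzmann' {R S : Type*} [CommRing R] [CommRing S] (φ : R →+* S) (D : ℕ)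
    (s t : β → V) (f : V → ℕ → R) (g : β → ℕ → R) :
    MvPolynomial.map φ (boltzmann D s t f g) =
      boltzmann D s t (fun x j => φ (f x j)) (fun b j => φ (g b j)) := by
  unfold boltzmann siteFactor bondFactor
  simp only [map_mul, map_prod, map_sum, map_pow, map_C, map_X]

/-- Functoriality of `Z` in the coefficient ring. [folklore] -/
private theorem map_Z' {R S : Type*} [CommRing R] [CommRing S] (φ : R →+* S) (D : ℕ) (s t : β → V)
    (f : V → ℕ → R) (g : β → ℕ → R) (c : V →₀ ℕ) :
    φ (Z D s t f g c) = Z D s t (fun x j => φ (f x j)) (fun b j => φ (g b j)) c := by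
  unfold Z
  rw [← coeff_map, map_boltzmann']

/-- **Evaluating the bond variables** at `τ` gives the capacity partition function with the numerical
bond data `g_b(j) τ_b^j`. [cite: SalmhoferSeiler1991, Def. 3.1 and (3.5)–(3.7)] -/
theorem eval_Zgen (D : ℕ) (s t : β → V) (f : V → ℕ → 𝕜) (g : β → ℕ → 𝕜) (c : V →₀ ℕ)
    (τ : β → 𝕜) :
    eval τ (Zgen D s t f g c) = Z D s t f (scaledBond g τ) c := by
  unfold Zgen
  rw [map_Z']
  congr 1
  · funext x j; simp
  · funext b j; simp [genBond, scaledBond]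

variable {ι : Type*} [LinearOrder ι]

/-- **The cleared truncated function of a family of monomial observables, as a polynomial in the bond
variables**: `Ursell.clearedUrsell` of `z(A) = Z̃(c₀ - ∑_{i∈A} L_i)`, `z₀ = Z̃(c₀)` — for the top
capacity `c₀ = (N,…,N)` of a complex spin system this is `Z̃^{|S|} ⟨σ^{L_{i₁}}; …; σ^{L_{i_n}}⟩^T`.
[cite: SalmhoferSeiler1991, Thm. 3.11 and (3.33)] -/
def ursellGen (D : ℕ) (s t : β → V) (f : V → ℕ → 𝕜) (g : β → ℕ → 𝕜) (c₀ : V →₀ ℕ)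
    (L : ι → V →₀ ℕ) (S : Finset ι) : MvPolynomial β 𝕜 :=
  Ursell.clearedUrsell (fun A => Zgen D s t f g (c₀ - ∑ i ∈ A, L i)) (Zgen D s t f g c₀) S

/-- Evaluating the bond variables commutes with the cleared Ursell recursion. [cite: SalmhoferSeiler1991, Thm. 3.11 and (3.33)] -/
theorem eval_ursellGen (D : ℕ) (s t : β → V) (f : V → ℕ → 𝕜) (g : β → ℕ → 𝕜) (c₀ : V →₀ ℕ)
    (L : ι → V →₀ ℕ) (S : Finset ι) (τ : β → 𝕜) :
    eval τ (ursellGen D s t f g c₀ L S) =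
      Ursell.clearedUrsell (fun A => Z D s t f (scaledBond g τ) (c₀ - ∑ i ∈ A, L i))
        (Z D s t f (scaledBond g τ) c₀) S := by
  unfold ursellGen
  rw [Ursell.map_clearedUrsell (eval τ)]
  simp only [eval_Zgen]

/-! ### Killing variables -/

/-- The algebra endomorphism of `𝕜[t]` killing the variables outside `K`: `t_b ↦ t_b` (`b ∈ K`),
`t_b ↦ 0` (`b ∉ K`). [folklore] -/
def killVars (K : Finset β) [DecidableEq β] : MvPolynomial β 𝕜 →ₐ[𝕜] MvPolynomial β 𝕜 :=
  aeval fun b => if b ∈ K then X b else 0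

omit [Fintype V] [Fintype β] in
/-- **Killing the variables outside `K` does not change the coefficients of monomials supported in
`K`.** [folklore] -/
private theorem coeff_killVars [DecidableEq β] {K : Finset β} {k : β →₀ ℕ} (hk : k.support ⊆ K)
    (p : MvPolynomial β 𝕜) : coeff k (killVars K p) = coeff k p := by
  induction p using MvPolynomial.induction_on' with
  | monomial d a =>
    rw [killVars, aeval_monomial, coeff_monomial, algebraMap_eq]
    by_cases hd : d.support ⊆ K
    · have hprod : (d.prod fun i e => (if i ∈ K then X i else (0 : MvPolynomial β 𝕜)) ^ e) =
          d.prod fun i e => (X i : MvPolynomial β 𝕜) ^ e := by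
        refine Finsupp.prod_congr fun i hi => ?_
        rw [if_pos (hd hi)]
      rw [hprod, ← monomial_eq, coeff_monomial]
    · obtain ⟨b, hbd, hbK⟩ := not_subset.1 hd
      have hzero : (d.prod fun i e => (if i ∈ K then X i else (0 : MvPolynomial β 𝕜)) ^ e) = 0 := by
        rw [Finsupp.prod]
        apply prod_eq_zero hbd
        rw [if_neg hbK, zero_pow (Finsupp.mem_support_iff.1 hbd)]
      rw [hzero, mul_zero, coeff_zero]
      have hne : d ≠ k := fun h => hbK (hk (h ▸ hbd))
      rw [if_neg hne]
  | add p q hp hq => rw [map_add, coeff_add, coeff_add, hp, hq]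

omit [Fintype V] [Fintype β] in
/-- Killing then evaluating at `τ` = evaluating at `τ` set to `0` outside `K`. [folklore] -/
private theorem eval_killVars [DecidableEq β] (K : Finset β) (τ : β → 𝕜) (p : MvPolynomial β 𝕜) :
    eval τ (killVars K p) = eval (fun b => if b ∈ K then τ b else 0) p := by
  induction p using MvPolynomial.induction_on with
  | C a => rw [killVars, aeval_C, algebraMap_eq, eval_C, eval_C]
  | add p q hp hq => rw [map_add, map_add, map_add, hp, hq]
  | mul_X p b hp =>
    rw [map_mul, map_mul, map_mul, hp, eval_X]
    congr 1
    rw [killVars, aeval_X]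
    split_ifs with h
    · rw [eval_X]
    · rw [map_zero]

/-! ### The support theorem -/

omit [Fintype V] [Fintype β] in
/-- With a variable killed, the corresponding bond is switched off (if `B_b(0) = 1`). [cite: SalmhoferSeiler1991, (3.5)–(3.6)] -/
private theorem bondFactor_scaledBond_eq_one {D : ℕ} {s t : β → V} {g : β → ℕ → 𝕜} {τ : β → 𝕜}
    {b : β} (hg0 : g b 0 = 1) (hτ : τ b = 0) : bondFactor D s t (scaledBond g τ) b = 1 := by
  apply bondFactor_eq_one
  · simp [scaledBond, hg0]
  · intro j hj
    simp [scaledBond, hτ, zero_pow (Nat.one_le_iff_ne_zero.1 hj)]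

variable [DecidableEq V] [DecidableEq β] [Infinite 𝕜]

/-- **The support theorem.**  Let all bonds have constant Taylor coefficient `B_b(0) = 1`, let the
reference capacity satisfy `c₀ ≤ D` and `f_x(c₀(x)) ≠ 0` for all `x` (so that `Z̃(c₀)` has nonzero
constant term).  Then every monomial `∏_b t_b^{k_b}` occurring in the cleared truncated function
`ursellGen` of the observables `σ^{L_i}`, `i ∈ S`, has a bond support `{b : k_b ≠ 0}` which LINKS the
family: truncated functions are carried by connected bond clusters only. [cite: SalmhoferSeiler1991, Thm. 3.11 (proof, p. 408)][cite: Haag1996, §II.2.2 (II.2.15)–(II.2.19)] -/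
theorem isLinking_of_mem_support_ursellGen {D : ℕ} {s t : β → V} {f : V → ℕ → 𝕜}
    {g : β → ℕ → 𝕜} {c₀ : V →₀ ℕ} {L : ι → V →₀ ℕ} {S : Finset ι}
    (hg0 : ∀ b, g b 0 = 1) (hc₀ : ∀ x, c₀ x ≤ D) (hf : ∀ x, f x (c₀ x) ≠ 0)
    {k : β →₀ ℕ} (hk : k ∈ (ursellGen D s t f g c₀ L S).support) :
    IsLinking s t (↑k.support : Set β) L S := by
  classical
  by_contra hnot
  -- a separated proper sub-family `I`
  obtain ⟨I, hIS, hIne, hIneS, hsep⟩ : ∃ I ⊆ S, I.Nonempty ∧ I ≠ S ∧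
      ∀ i ∈ I, ∀ j ∈ S, j ∉ I → ∀ x ∈ (L i).support, ∀ y ∈ (L j).support,
        ¬(bondGraph s t (↑k.support : Set β)).Reachable x y := by
    simp only [IsLinking, not_forall, not_exists, not_and] at hnot
    obtain ⟨I, hIS, hIne, hIneS, h⟩ := hnot
    exact ⟨I, hIS, hIne, hIneS, fun i hi j hj hjI x hx y hy hxy => h i hi j hj hjI x hx y hy hxy⟩
  set K : Finset β := k.support with hK
  set G := bondGraph s t (↑K : Set β) with hG
  have hSne : S.Nonempty := hIne.mono hIS
  -- the `K`-hull of the `I`-side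
  let P : V → Prop := fun x => ∃ i ∈ I, ∃ y ∈ (L i).support, G.Reachable y x
  have hP_of_mem : ∀ i ∈ I, ∀ y ∈ (L i).support, P y :=
    fun i hi y hy => ⟨i, hi, y, hy, SimpleGraph.Reachable.refl _⟩
  have hP_step : ∀ {x x' : V}, G.Reachable x x' → P x → P x' :=
    fun hxx' ⟨i, hi, y, hy, hyx⟩ => ⟨i, hi, y, hy, hyx.trans hxx'⟩
  -- Step 1: the coefficient survives the killing of the variables outside `K`
  have hcoeff : coeff k (killVars K (ursellGen D s t f g c₀ L S)) ≠ 0 := by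
    rw [coeff_killVars (by rw [hK])]
    exact mem_support_iff.1 hk
  apply hcoeff
  -- Step 2: the killed polynomial vanishes; we show (killed U) · (killed Z̃(c₀)) = 0 pointwise
  suffices h0 : killVars K (ursellGen D s t f g c₀ L S) * killVars K (Zgen D s t f g c₀) = 0 by
    have hQ : killVars K (Zgen D s t f g c₀) ≠ 0 := by
      intro hQ0
      have h := congrArg (eval (0 : β → 𝕜)) hQ0
      rw [eval_killVars, map_zero] at h
      have h' : eval (fun b => if b ∈ K then (0 : β → 𝕜) b else 0) (Zgen D s t f g c₀) =
          ∏ x, f x (c₀ x) := by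
        rw [eval_Zgen, Z_trivialBonds D s t f _ (fun b => ?_) hc₀]
        refine bondFactor_scaledBond_eq_one (hg0 b) ?_
        split_ifs <;> rfl
      rw [h'] at h
      exact (prod_ne_zero_iff.2 fun x _ => hf x) h
    rcases mul_eq_zero.1 h0 with h | h
    · rw [h, coeff_zero]
    · exact absurd h hQ
  apply MvPolynomial.funext
  intro τ
  rw [map_mul, map_zero, eval_killVars, eval_killVars, eval_ursellGen, eval_Zgen]
  set τK : β → 𝕜 := fun b => if b ∈ K then τ b else 0 with hτK
  clear_value τK
  set gτ := scaledBond g τK with hgτ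
  clear_value gτ
  by_cases hz₀ : Z D s t f gτ c₀ = 0
  · rw [hz₀, mul_zero]
  -- Step 3: at this numerical point the partition functions factorise across the cut `P`
  have hsepB : ∀ b, (P (s b) ↔ P (t b)) ∨ bondFactor D s t gτ b = 1 := by
    intro b
    by_cases hb : b ∈ K
    · left
      have hr : G.Reachable (s b) (t b) := bondGraph_reachable s t (by exact_mod_cast hb)
      exact ⟨hP_step hr, hP_step hr.symm⟩
    · right
      rw [hgτ]
      refine bondFactor_scaledBond_eq_one (hg0 b) ?_
      rw [hτK]
      exact if_neg hb
  obtain ⟨Z₁, Z₂, hfac⟩ := Z_eq_mul_of_separated D s t f gτ P hsepB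
  have hZ₁ : Z₁ (c₀.filter P) ≠ 0 := fun h => hz₀ (by rw [hfac c₀, h, zero_mul])
  have hZ₂ : Z₂ (c₀.filter fun x => ¬P x) ≠ 0 := fun h => hz₀ (by rw [hfac c₀, h, mul_zero])
  -- the two halves of a capacity `c₀ - L_A` only see the observables on their own side
  have hfilt₁ : ∀ A ⊆ S, (c₀ - ∑ i ∈ A, L i).filter P =
      (c₀ - ∑ i ∈ A.filter (fun i => i ∈ I), L i).filter P := by
    intro A hA
    ext x
    by_cases hx : P x
    · rw [Finsupp.filter_apply, Finsupp.filter_apply, if_pos hx, if_pos hx, Finsupp.tsub_apply,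
        Finsupp.tsub_apply, Finsupp.finsetSum_apply, Finsupp.finsetSum_apply, Finset.sum_filter]
      congr 1
      refine sum_congr rfl fun i hi => ?_
      by_cases hiI : i ∈ I
      · rw [if_pos hiI]
      · rw [if_neg hiI]
        by_contra hne
        have hix : x ∈ (L i).support := Finsupp.mem_support_iff.2 hne
        obtain ⟨i', hi', y, hy, hyx⟩ := hx
        exact hsep i' hi' i (hA hi) hiI y hy x hix hyx
    · rw [Finsupp.filter_apply, Finsupp.filter_apply, if_neg hx, if_neg hx]
  have hfilt₂ : ∀ A ⊆ S, (c₀ - ∑ i ∈ A, L i).filter (fun x => ¬P x) =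
      (c₀ - ∑ i ∈ A.filter (fun i => i ∉ I), L i).filter (fun x => ¬P x) := by
    intro A hA
    ext x
    by_cases hx : P x
    · rw [Finsupp.filter_apply, Finsupp.filter_apply, if_neg (not_not_intro hx),
        if_neg (not_not_intro hx)]
    · rw [Finsupp.filter_apply, Finsupp.filter_apply, if_pos hx, if_pos hx, Finsupp.tsub_apply,
        Finsupp.tsub_apply, Finsupp.finsetSum_apply, Finsupp.finsetSum_apply, Finset.sum_filter]
      congr 1
      refine sum_congr rfl fun i hi => ?_
      by_cases hiI : i ∉ I
      · rw [if_pos hiI]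
      · rw [if_neg hiI]
        by_contra hne
        have hix : x ∈ (L i).support := Finsupp.mem_support_iff.2 hne
        exact hx (hP_of_mem i (not_not.1 hiI) x hix)
  -- Step 4: the genuine truncated function at this point, and the independence lemma
  set E : Finset ι → 𝕜 := fun A => Z D s t f gτ (c₀ - ∑ i ∈ A, L i) / Z D s t f gτ c₀ with hE
  set E₁ : Finset ι → 𝕜 := fun A => Z₁ ((c₀ - ∑ i ∈ A, L i).filter P) / Z₁ (c₀.filter P) with hE₁
  set E₂ : Finset ι → 𝕜 :=
    fun A => Z₂ ((c₀ - ∑ i ∈ A, L i).filter fun x => ¬P x) / Z₂ (c₀.filter fun x => ¬P x) with hE₂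
  have hcl : Ursell.clearedUrsell (fun A => Z D s t f gτ (c₀ - ∑ i ∈ A, L i)) (Z D s t f gτ c₀) S =
      Z D s t f gτ c₀ ^ S.card * Ursell.ursell E S := by
    refine Ursell.clearedUrsell_eq (fun A _ _ => ?_) hSne
    rw [hE]
    field_simp
  have hu : Ursell.ursell E S = 0 := by
    refine Ursell.ursell_eq_zero_of_factorizes (fun i => i ∈ I) (E₁ := E₁) (E₂ := E₂)
      (fun A hA => ?_) ?_ ?_ ?_ ?_
    · simp only [hE, hE₁, hE₂]
      rw [hfac (c₀ - ∑ i ∈ A, L i), hfac c₀, hfilt₁ A hA, hfilt₂ A hA, div_mul_div_comm]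
    · simp only [hE₁, sum_empty, tsub_zero]
      exact div_self hZ₁
    · simp only [hE₂, sum_empty, tsub_zero]
      exact div_self hZ₂
    · obtain ⟨i, hi⟩ := hIne
      exact ⟨i, hIS hi, hi⟩
    · obtain ⟨j, hj, hjI⟩ := exists_of_ssubset (Finset.ssubset_iff_subset_ne.2 ⟨hIS, hIneS⟩)
      exact ⟨j, hj, hjI⟩
  rw [hcl, hu, mul_zero, zero_mul]

/-- **The truncated functions are of order at least the tree length in the bond variables**: every
monomial of `ursellGen` has total degree `≥ ϑ(L, S)`, the Steiner bond number of the family.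
[cite: SalmhoferSeiler1991, Thm. 3.11 (3.32)] -/
theorem steiner_le_degree_of_mem_support_ursellGen {D : ℕ} {s t : β → V} {f : V → ℕ → 𝕜}
    {g : β → ℕ → 𝕜} {c₀ : V →₀ ℕ} {L : ι → V →₀ ℕ} {S : Finset ι}
    (hg0 : ∀ b, g b 0 = 1) (hc₀ : ∀ x, c₀ x ≤ D) (hf : ∀ x, f x (c₀ x) ≠ 0)
    {k : β →₀ ℕ} (hk : k ∈ (ursellGen D s t f g c₀ L S).support) :
    steiner s t L S ≤ k.degree := by
  calc steiner s t L S ≤ k.support.card :=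
        steiner_le_card s t (isLinking_of_mem_support_ursellGen hg0 hc₀ hf hk)
    _ ≤ k.degree := by
        rw [Finsupp.degree_apply, Finset.card_eq_sum_ones]
        exact Finset.sum_le_sum fun b hb => Nat.one_le_iff_ne_zero.2 (Finsupp.mem_support_iff.1 hb)

end Generic

end MonomerDimer

end Literature.MathematicalPhysics.StatisticalMechanics
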